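import Summits.SmoothPoincare4.SmoothPoincare4.Theorems.InformationMetricHadamardHadamardConvexBoundarySphere

/-!
# `ConvexEndRecognition` (route InformationMetricHadamard, item stmt-SmoothPoincare4-6017)

The convex-slice recognition statement of route InformationMetricHadamard, proved: if a homotopy
4-sphere `Σ` is the cross-section of a proper, smooth, injective, immersive end collar
`Φ : Σ × (0,1) → W` of a complete simply connected Riemannian 5-manifold with sectional curvature
`≤ 0`, and some complement `K_t = W \ Φ(Σ × (0,t))` of a far collar is convex with nonempty
interior, then `Σ ≅ S⁴`.

Proof = bookkeeping + `hadamardConvexBoundarySphere_proof`: `Φ` is open on `Σ × (0,1)` (inverse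
function theorem, `isLocalDiffeomorphAt_of_mfderiv_injective`), so with injectivity and the closure
condition `closure Φ(Σ × (0,t)) ⊆ Φ(Σ × (0,1))` one gets `frontier K_t = Φ(Σ × {t})`, the image of
the injective immersion `x ↦ Φ(x, t)` of the compact 4-manifold `Σ`. Everything is proved (no
`sorry`, no definition, no named fact).

References: J. M. Lee, *Introduction to Riemannian Manifolds* (2018), Thm. 12.8; D. Groisser,
M. K. Murray, dg-ga/9611008 (1997), Thm. 3.1 (the collar shape).
-/

noncomputable section

-- the registered namespace `Summit.SmoothPoincare4.SmoothPoincare4.Theorems` repeats a component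
set_option linter.dupNamespace false

open Set Filter Function
open scoped Manifold ContDiff Topology

namespace Summit.SmoothPoincare4.SmoothPoincare4.Theorems

open Literature.Topology.FourManifolds

set_option maxSynthPendingDepth 3 in
/-- **`ConvexEndRecognition`** (item stmt-SmoothPoincare4-6017 of route InformationMetricHadamard,
verbatim): the cross-section `Σ` of a proper smooth injective immersive end collar of a
Cartan–Hadamard 5-manifold, one of whose far-collar complements `K_t` is convex with nonempty
interior, is diffeomorphic to `S⁴` — `frontier K_t = Φ(Σ × {t})` and
`hadamardConvexBoundarySphere_proof`. [cite: Lee2018, Thm. 12.8] -/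
theorem convexEndRecognition_proof :
    _root_.Summit.SmoothPoincare4.SmoothPoincare4.Theses.InformationMetricHadamard.ConvexEndRecognition := by
  intro S W _ _ _ _ _ _ G hG Φ hcpt hsec hsm hinj himm hco hcl hconv
  obtain ⟨t, ht, hKi, hK⟩ := hconv
  -- the collar domain and the inverse function theorem on it
  have hA1o : IsOpen (univ ×ˢ Ioo (0 : ℝ) 1 : Set (S.carrier × ℝ)) := isOpen_univ.prod isOpen_Ioo
  have hloc : ∀ p ∈ (univ ×ˢ Ioo (0 : ℝ) 1 : Set (S.carrier × ℝ)),
      IsLocalDiffeomorphAt ((𝓡 4).prod 𝓘(ℝ, ℝ)) (𝓡 5) ∞ Φ p := fun p hp ↦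
    isLocalDiffeomorphAt_of_mfderiv_injective hA1o hp hsm (by exact_mod_cast le_top)
      (by simp [Module.finrank_prod]) (himm p hp)
  -- `Φ` is open on open subsets of the collar domain
  have hopen : ∀ V : Set (S.carrier × ℝ), IsOpen V → V ⊆ univ ×ˢ Ioo (0 : ℝ) 1 →
      IsOpen (Φ '' V) := by
    intro V hV hV1
    rw [isOpen_iff_forall_mem_open]
    rintro _ ⟨p, hp, rfl⟩
    obtain ⟨e, hpe, heq⟩ := hloc p (hV1 hp)
    refine ⟨Φ '' (V ∩ e.source), image_mono inter_subset_left, ?_, ⟨p, ⟨hp, hpe⟩, rfl⟩⟩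
    rw [image_congr fun a ha ↦ heq ha.2]
    exact e.toOpenPartialHomeomorph.isOpen_image_of_subset_source (hV.inter e.open_source)
      inter_subset_right
  -- the slice `j = Φ(·, t)`
  set j : S.carrier → W := fun x ↦ Φ (x, t) with hjdef
  have hxt : ∀ x : S.carrier, (x, t) ∈ (univ ×ˢ Ioo (0 : ℝ) 1 : Set (S.carrier × ℝ)) :=
    fun x ↦ ⟨mem_univ _, ht⟩
  have hj : ContMDiff (𝓡 4) (𝓡 5) ∞ j :=
    hsm.comp_contMDiff (contMDiff_id.prodMk contMDiff_const) hxt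
  have hjinj : Injective j := fun x₁ x₂ h ↦ (Prod.ext_iff.1 (hinj (hxt x₁) (hxt x₂) h)).1
  have hjimm : ∀ x, Injective (mfderiv (𝓡 4) (𝓡 5) j x) := by
    intro x
    have hΦd : MDifferentiableAt ((𝓡 4).prod 𝓘(ℝ, ℝ)) (𝓡 5) Φ (x, t) :=
      (hsm.contMDiffAt (hA1o.mem_nhds (hxt x))).mdifferentiableAt (by simp)
    have hιd : MDifferentiableAt (𝓡 4) ((𝓡 4).prod 𝓘(ℝ, ℝ)) (fun y : S.carrier ↦ (y, t)) x :=
      (contMDiff_id.prodMk contMDiff_const).mdifferentiableAt (n := ∞) (by simp)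
    have hcomp : mfderiv (𝓡 4) (𝓡 5) j x = (mfderiv ((𝓡 4).prod 𝓘(ℝ, ℝ)) (𝓡 5) Φ (x, t)).comp
        (mfderiv (𝓡 4) ((𝓡 4).prod 𝓘(ℝ, ℝ)) (fun y : S.carrier ↦ (y, t)) x) :=
      mfderiv_comp x hΦd hιd
    rw [hcomp, mfderiv_prod_left]
    intro ξ₁ ξ₂ h
    have h' := himm (x, t) (hxt x) h
    exact (Prod.ext_iff.1 h').1
  -- topology of the collar: `frontier K_t = Φ(Σ × {t})`
  have hsub_t : (univ ×ˢ Ioo (0 : ℝ) t : Set (S.carrier × ℝ)) ⊆ univ ×ˢ Ioo (0 : ℝ) 1 :=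
    prod_mono Subset.rfl (Ioo_subset_Ioo_right ht.2.le)
  have hopen_t : IsOpen (Φ '' (univ ×ˢ Ioo (0 : ℝ) t)) :=
    hopen _ (isOpen_univ.prod isOpen_Ioo) hsub_t
  have hnot : ∀ x, j x ∉ Φ '' (univ ×ˢ Ioo (0 : ℝ) t) := by
    rintro x ⟨⟨x', l'⟩, ⟨-, hl'⟩, h⟩
    have h1 := hinj (hsub_t ⟨mem_univ x', hl'⟩) (hxt x) h
    have h2 : l' = t := (Prod.ext_iff.1 h1).2
    exact hl'.2.ne h2
  have hclos : ∀ x, j x ∈ closure (Φ '' (univ ×ˢ Ioo (0 : ℝ) t)) := by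
    intro x
    have hcont : ContinuousAt Φ (x, t) := hsm.continuousOn.continuousAt (hA1o.mem_nhds (hxt x))
    have hT : Tendsto (fun s : ℝ ↦ Φ (x, s)) (𝓝[<] t) (𝓝 (Φ (x, t))) :=
      (hcont.tendsto.comp ((continuous_const.prodMk continuous_id).tendsto t)).mono_left
        nhdsWithin_le_nhds
    refine mem_closure_of_tendsto hT ?_
    filter_upwards [Ioo_mem_nhdsLT ht.1] with s hs
    exact ⟨(x, s), ⟨mem_univ _, hs⟩, rfl⟩
  have hfr : frontier (Φ '' (univ ×ˢ Ioo (0 : ℝ) t))ᶜ =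
      closure (Φ '' (univ ×ˢ Ioo (0 : ℝ) t)) \ Φ '' (univ ×ˢ Ioo (0 : ℝ) t) := by
    rw [frontier_compl, hopen_t.frontier_eq]
  have hjr : range j = frontier (Φ '' (univ ×ˢ Ioo (0 : ℝ) t))ᶜ := by
    rw [hfr]
    refine Subset.antisymm ?_ ?_
    · rintro _ ⟨x, rfl⟩
      exact ⟨hclos x, hnot x⟩
    · rintro y ⟨hyc, hyn⟩
      obtain ⟨⟨x, l⟩, ⟨-, hl⟩, rfl⟩ := hcl t ht hyc
      rcases lt_trichotomy l t with hlt | rfl | hgt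
      · exact absurd ⟨(x, l), ⟨mem_univ _, hl.1, hlt⟩, rfl⟩ hyn
      · exact ⟨x, rfl⟩
      · exfalso
        have hVo : IsOpen (Φ '' (univ ×ˢ Ioo t 1)) :=
          hopen _ (isOpen_univ.prod isOpen_Ioo) (prod_mono Subset.rfl (Ioo_subset_Ioo_left ht.1.le))
        obtain ⟨z, ⟨⟨x₁, l₁⟩, ⟨-, hl₁⟩, rfl⟩, ⟨⟨x₂, l₂⟩, ⟨-, hl₂⟩, hz⟩⟩ :=
          mem_closure_iff.1 hyc _ hVo ⟨(x, l), ⟨mem_univ _, hgt, hl.2⟩, rfl⟩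
        have h1 := hinj (hsub_t ⟨mem_univ x₂, hl₂⟩) ⟨mem_univ x₁, ht.1.trans hl₁.1, hl₁.2⟩ hz
        have h2 : l₂ = l₁ := (Prod.ext_iff.1 h1).2
        exact (lt_irrefl t) ((hl₁.1.trans_eq h2.symm).trans hl₂.2)
  exact hadamardConvexBoundarySphere_proof W G hG hcpt hsec _ (hco t ht) hKi hK S.carrier j hj
    hjinj hjimm hjr

end Summit.SmoothPoincare4.SmoothPoincare4.Theorems

end
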